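import Summits.ValiantsHypothesis.ValiantsHypothesis.Theses.DetQP
import Summits.ValiantsHypothesis.ValiantsHypothesis.Theses.UlrichPadded
import Summits.ValiantsHypothesis.ValiantsHypothesis.Theorems.DetQPDetqpSuperquadraticStubVertexGauge
import Summits.ValiantsHypothesis.ValiantsHypothesis.Theorems.DetQPDetqpSuperquadraticStubKrylovIdentities
import Summits.ValiantsHypothesis.ValiantsHypothesis.Theorems.DetQPDetqpSuperquadraticStubTraceUnrolling
import Literature.Computability.AlgebraicComplexity.OrbitClosureProofs
import Literature.Computability.AlgebraicComplexity.DeterminantalComplexityProofs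
import Literature.Computability.AlgebraicComplexity.StandardFamiliesProofs
import Literature.Barriers.ValiantsHypothesis.GCTMatrixPoweringGrenet

/-!
# Line `linear-homogenisation-transfer` — skeleton v4 for crux `DetQP.DetqpSuperquadratic`
# (stmt-ValiantsHypothesis-0318; routes DetQP (decl `DetqpSuperquadratic`) and UlrichPadded
# (decl `Superquadratic`, same term) — shared item)

Crux (by name): `Summit.ValiantsHypothesis.ValiantsHypothesis.Theses.DetQP.DetqpSuperquadratic` =
`∃ ε > 0, ∃ n₀, ∀ n ≥ n₀, (n:ℝ)^(2+ε) ≤ dc(per_n)` over `ℂ` (floor `n²/2` MR04, ceiling `2ⁿ − 1` Grenet,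
both in tree).

## State (lead gen 1, cycle 2, 2026-08-16)

v1–v3 (planner + lead gen 0): the crux is reduced to ONE width statement about KRYLOV NORMAL FORMS of
the permanent — homogeneous linear `ρ, γ ∈ (S¹)^w`, `L ∈ M_w(S¹)` with (A3) `ρᵀ L^(n−2) γ = per_n`,
(A2) `ρᵀ Lʲ γ = 0` (`j < n−2`), (A4) `per_n ∣ ρᵀ Lʲ γ` (all `j`).  LANDED (all ACCEPTED, imported
below, no longer stubs): S1a `stub_vertexGauge` (p86508), S1b `stub_krylovIdentities` (p86509),
S2 `stub_traceUnrolling` (p86648), S2½ `stub_krylovMRFloor` (p87997: `n² ≤ 2w + 4` inside the model),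
and the by-product `pc(per_n) + 1 ≤ 2·dc(per_n)` (`…LinearHomogenisation`).

v4 (this cycle) — THE BORDER SANDWICH.  A Krylov form of width `w` (only (A2), (A3) are used) is a
BORDER determinantal expression of size `w + 1`:
  `A = [[0, −ρᵀ], [γ, 1 − L]]` is affine of size `w+1` with `det A = ρᵀ adj(1 − L) γ =
  det(1−L)·per_n + ρᵀ L^(n−1) adj(1−L) γ = per_n + (order ≥ n+1)` (stub `stub_krylovAdjugateOrder`),
  and the INITIAL FORM of any polynomial with an affine determinantal expression of size `m` is a
  degeneration of `det_m` (homogenise with `X₀₀`, rescale the block variables by `t`, divide by `tⁿ`,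
  let `t → 0` in the Zariski topology: stubs `stub_initialFormFamily` + `stub_zariskiLimit`).
Hence `X₀₀^(w+1−n) per_n ∈ Δ[det_(w+1)]`, i.e. `bdc(per_n) ≤ kw(per_n) + 1 ≤ dc(per_n)`
(`krylovBorder`, `borderDetComplexityPer_le_of_krylov`), and the open transfer stub S3 is SANDWICHED:
  border crux (`n^(2+ε) ≤ bdc(per_n)` eventually)  ⟹  S3  ⟹  crux
(`krylovWidthSuperquadratic_stub_of_border`, `DetqpSuperquadratic_of`).  S3 v4 carries the border
expression as a further free hypothesis and concludes `n^(2+ε) ≤ w + 1` (= dc at the attained width),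
which is all the composition needs.

## Registered stubs (v4.2): B1 `stub_zariskiLimit` (LANDED p96556), B2 `stub_initialFormFamily` (LANDED p96919),
B3 `stub_krylovAdjugateOrder` (LANDED p96688), B4 `stub_krylovBorder` (= B1+B2+B3, lead, LANDED p97435), S2½
`stub_krylovMRFloor` (LANDED p87997, placeholder until the farm builds the module), S3
`stub_krylovWidthSuperquadratic` (OPEN, hardest — at least crux-hard: Krylov forms ⊇ vertex-gauge
determinantal expressions; at most border-crux-hard by v4).  Landed stubs stay `sorry` placeholders here
only because the lead's farm view has not built their modules yet (rc 75 stale on import).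

## Disproof.lean used (cdisprove v7, `Cruxes/DetqpSuperquadratic/Disproof.lean`): load-bearing char 0 /
permanent / threshold (honoured: S1a uses vzG; `n₀ ↦ max n₀ 3`); engine ceilings (Hessian `n²/2` tight —
S2½ is exactly that engine inside the model; Sing `≤ 2n+1`; ELSW) — no stub is a point-invariant
statement; `-- Targets`: none handed over; no `Negative/*` landed.
-/

noncomputable section

namespace Summit.ValiantsHypothesis.ValiantsHypothesis.Cruxes.DetqpSuperquadratic.LinearHomogenisationTransfer

open MvPolynomial Matrix
open Literature.Computability.AlgebraicComplexity
open Literature.Barriers.ValiantsHypothesis (HasPowTraceRepr powTraceComplexity GIP2017_pc_le_holds)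
open Summit.ValiantsHypothesis.ValiantsHypothesis.Theorems.DetQPDetqpSuperquadratic
  (stub_vertexGauge stub_krylovIdentities stub_traceUnrolling)

set_option linter.unusedVariables false
set_option linter.dupNamespace false
set_option linter.unusedSectionVars false

/-! ## Objects -/

/-- **Krylov normal form of width `w` for `per_n`**: homogeneous LINEAR `ρ, γ ∈ (S¹)^w`,
`L ∈ M_w(S¹)`, `S = ℂ[x_ij]`, with (A3) `ρᵀ L^(n−2) γ = per_n`, (A2) `ρᵀ L^j γ = 0` for `j < n − 2`,
(A4) `per_n ∣ ρᵀ L^j γ` for all `j`.  Deliberately WITHOUT the exact adjugate identity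
`ρᵀ adj(1+L) γ = per_n` (with it, Krylov forms of width `w` ⟺ determinantal expressions of size `w+1`
in vertex gauge, and S3 would restate the crux). -/
def HasKrylovRepr (n w : ℕ) : Prop :=
  ∃ (ρ γ : Fin w → MvPolynomial (Fin n × Fin n) ℂ)
    (L : Matrix (Fin w) (Fin w) (MvPolynomial (Fin n × Fin n) ℂ)),
    (∀ i, (ρ i).IsHomogeneous 1) ∧ (∀ i, (γ i).IsHomogeneous 1) ∧
    (∀ i j, (L i j).IsHomogeneous 1) ∧
    ρ ⬝ᵥ ((L ^ (n - 2)) *ᵥ γ) = perPoly (Fin n) ℂ ∧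
    (∀ j < n - 2, ρ ⬝ᵥ ((L ^ j) *ᵥ γ) = 0) ∧
    (∀ j : ℕ, perPoly (Fin n) ℂ ∣ ρ ⬝ᵥ ((L ^ j) *ᵥ γ))

/-- **Bordered adjugate form of width `w` for `per_n`** (the output of the vertex gauge S1a):
`per_n = ρᵀ adj(1 + L) γ` with `ρ, γ, L` homogeneous LINEAR. -/
def HasAdjugateForm (n w : ℕ) : Prop :=
  ∃ (ρ γ : Fin w → MvPolynomial (Fin n × Fin n) ℂ)
    (L : Matrix (Fin w) (Fin w) (MvPolynomial (Fin n × Fin n) ℂ)),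
    (∀ i, (ρ i).IsHomogeneous 1) ∧ (∀ i, (γ i).IsHomogeneous 1) ∧
    (∀ i j, (L i j).IsHomogeneous 1) ∧
    ρ ⬝ᵥ ((1 + L).adjugate *ᵥ γ) = perPoly (Fin n) ℂ

/-- Bordered matrix-power presentation of length `d` and width `w` (no side identities). -/
def HasBorderedPowerRepr {σ : Type*} (f : MvPolynomial σ ℂ) (d w : ℕ) : Prop :=
  ∃ (ρ γ : Fin w → MvPolynomial σ ℂ) (L : Matrix (Fin w) (Fin w) (MvPolynomial σ ℂ)),
    (∀ i, (ρ i).IsHomogeneous 1) ∧ (∀ i, (γ i).IsHomogeneous 1) ∧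
    (∀ i j, (L i j).IsHomogeneous 1) ∧ ρ ⬝ᵥ ((L ^ (d - 2)) *ᵥ γ) = f

/-- A Krylov normal form is in particular a bordered power presentation (forget (A2), (A4)). -/
theorem HasKrylovRepr.hasBorderedPowerRepr {n w : ℕ} (h : HasKrylovRepr n w) :
    HasBorderedPowerRepr (perPoly (Fin n) ℂ) n w := by
  obtain ⟨ρ, γ, L, hρ, hγ, hL, hA3, -, -⟩ := h
  exact ⟨ρ, γ, L, hρ, hγ, hL, hA3⟩

/-! ## The planner's `Prop`s S1a, S1b, S2, S3 (S3 in its v1 form) -/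

/-- **S1a `VertexGauge`** (LANDED p86508). -/
def VertexGauge : Prop :=
  ∀ n : ℕ, 3 ≤ n → ∀ w : ℕ, HasDetRepr (perPoly (Fin n) ℂ) (w + 1) → HasAdjugateForm n w

/-- **S1b `KrylovIdentities`** (LANDED p86509). -/
def KrylovIdentities : Prop :=
  ∀ n : ℕ, 3 ≤ n → ∀ w : ℕ, HasAdjugateForm n w → HasKrylovRepr n w

/-- **S2 `TraceUnrolling`** (LANDED p86648). -/
def TraceUnrolling : Prop :=
  ∀ n : ℕ, 3 ≤ n → ∀ w : ℕ, HasKrylovRepr n w → HasPowTraceRepr ℂ (perPoly (Fin n) ℂ) n (2 * w + 1)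

/-- **S3 `KrylovWidthSuperquadratic`** (v1 form, conclusion weakened to `≤ w + 1` in v4 — all the
composition needs, since `dc = w + 1` at the attained width): for all large `n`, a Krylov normal form
of `per_n` of width `w`, given with its power-trace twin of size `2w+1`, has `n^(2+ε) ≤ w + 1`. -/
def KrylovWidthSuperquadratic : Prop :=
  ∃ ε : ℝ, 0 < ε ∧ ∃ n₀ : ℕ, ∀ n ≥ n₀, ∀ w : ℕ,
    HasKrylovRepr n w → HasPowTraceRepr ℂ (perPoly (Fin n) ℂ) n (2 * w + 1) →
      (n : ℝ) ^ (2 + ε) ≤ (w : ℝ) + 1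


/-! ## Registered stubs (v4) — DEF-FREE signatures -/

/-- Registered stub **B1** `stub_zariskiLimit` (LANDED p96556, wave 2): orbit closures are closed under
`t → 0` along polynomial curves.  If `P₀ + t P₁ + ⋯ + t^E P_E ∈ Δ[f]` for every `t ≠ 0`, then
`P₀ ∈ Δ[f]`: for a test polynomial `p` vanishing on `GL · f`, `t ↦ p(coeffVec(Σ tᵉ Pₑ))` is a
univariate polynomial vanishing on `ℂ ∖ {0}`, hence identically, hence at `t = 0`. [folklore;
Mulmuley–Sohoni 2001 §4.1] -/
theorem stub_zariskiLimit :
    ∀ (σ : Type) [Fintype σ] [DecidableEq σ] (f : MvPolynomial σ ℂ) (P : ℕ → MvPolynomial σ ℂ)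
      (E : ℕ),
      (∀ t : ℂ, t ≠ 0 → (∑ e ∈ Finset.range (E + 1), t ^ e • P e) ∈ orbitClosure f) →
      P 0 ∈ orbitClosure f := by
  sorry  -- LANDED as Summit.ValiantsHypothesis.ValiantsHypothesis.Theorems.DetQPDetqpSuperquadratic.stub_zariskiLimit (p96556, wave 2); imported once the farm has built the module

/-- Registered stub **B2** `stub_initialFormFamily` (LANDED p96919, wave 2): the graded homogenisation of an
affine determinantal expression, rescaled.  If `F = det A` with `A` affine of size `m`, `F` has no
homogeneous component of degree `< n ≤ m`, `ι` places the variables of `F` among the `m²` matrix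
variables and the matrix variable `y` is not in the image of `ι`, then for every `t ≠ 0`
  `Σ_{e ≤ m−n} tᵉ · X_y^(m−n−e) · F_{n+e}(X_ι) ∈ End · det_m`
(homogenise the entries `a₀ + Σ a_s x_s ↦ a₀ X_y + Σ a_s X_{ι s}` as in the tree's
`X_pow_mul_rename_mem_endOrbit_detPoly`, getting `Σ_d X_y^(m−d) F_d(X_ι) ∈ End·det_m`; then substitute
`X_{ι s} ↦ t X_{ι s}` and divide by `tⁿ` — a scalar is absorbed by an `m`-th root rescaling of all
variables). [folklore; Mulmuley–Sohoni 2001 Prop. 4.4 + Landsberg 2017 §6] -/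
theorem stub_initialFormFamily :
    ∀ (n m : ℕ) (F : MvPolynomial (Fin n × Fin n) ℂ) (ι : Fin n × Fin n → Fin m × Fin m)
      (y : Fin m × Fin m),
      y ∉ Set.range ι → n ≤ m → HasDetRepr F m →
      (∀ d : ℕ, d < n → homogeneousComponent d F = 0) →
      ∀ t : ℂ, t ≠ 0 →
        (∑ e ∈ Finset.range (m - n + 1),
            t ^ e • (X y ^ (m - n - e) * rename ι (homogeneousComponent (n + e) F)))
          ∈ endOrbit (Fin m × Fin m) ℂ (detPoly (Fin m) ℂ) := by
  sorry  -- LANDED as Summit.ValiantsHypothesis.ValiantsHypothesis.Theorems.DetQPDetqpSuperquadratic.stub_initialFormFamily (p96919, wave 2); imported once the farm has built the module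

/-- Registered stub **B3** `stub_krylovAdjugateOrder` (LANDED p96688, wave 2): for Krylov data (A2), (A3) of
width `w` for `per_n` (`n ≥ 2`), the polynomial `F = ρᵀ adj(1 − L) γ` (i) is the determinant of the
affine bordered matrix `[[0, −ρᵀ],[γ, 1 − L]]` of size `w + 1` (tree: `VertexGauge.det_bordered`),
(ii) has no homogeneous component of degree `< n`, and (iii) has degree-`n` component `per_n`
(tree: `Krylov.adjugate_contraction_eq ρ γ L (n−1)` gives `F = det(1−L)·per_n + ρᵀ L^(n−1) adj(1−L) γ`,
`det(1−L) = 1 + (order ≥ 1)`, the last term has order `≥ n+1`). [folklore] -/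
theorem stub_krylovAdjugateOrder :
    ∀ (n w : ℕ) (ρ γ : Fin w → MvPolynomial (Fin n × Fin n) ℂ)
      (L : Matrix (Fin w) (Fin w) (MvPolynomial (Fin n × Fin n) ℂ)),
      2 ≤ n → (∀ i, (ρ i).IsHomogeneous 1) → (∀ i, (γ i).IsHomogeneous 1) →
      (∀ i j, (L i j).IsHomogeneous 1) →
      ρ ⬝ᵥ ((L ^ (n - 2)) *ᵥ γ) = perPoly (Fin n) ℂ →
      (∀ j : ℕ, j < n - 2 → ρ ⬝ᵥ ((L ^ j) *ᵥ γ) = 0) →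
      HasDetRepr (ρ ⬝ᵥ ((1 - L).adjugate *ᵥ γ)) (w + 1) ∧
      (∀ d : ℕ, d < n → homogeneousComponent d (ρ ⬝ᵥ ((1 - L).adjugate *ᵥ γ)) = 0) ∧
      homogeneousComponent n (ρ ⬝ᵥ ((1 - L).adjugate *ᵥ γ)) = perPoly (Fin n) ℂ := by
  sorry  -- LANDED as Summit.ValiantsHypothesis.ValiantsHypothesis.Theorems.DetQPDetqpSuperquadratic.stub_krylovAdjugateOrder (p96688, wave 2); imported once the farm has built the module

/-- Registered stub **B4** `stub_krylovBorder` (provable from B1–B3 — see `hasBorderDetRepr_of_initialForm`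
below for the derivation, kernel-checked modulo B1–B3; landed by the lead as
`Theorems/DetQPDetqpSuperquadraticKrylovBorder.lean` together with the corollaries `bdc(per_n) ≤ w + 1` and
"border crux ⟹ S3"): **a Krylov form of width `w` ((A2), (A3) only, `n ≥ 3`) is a BORDER determinantal
expression of size `w + 1`**, `X₀₀^(w+1−n) per_n ∈ Δ[det_(w+1)]`. -/
theorem stub_krylovBorder :
    ∀ (n w : ℕ) (ρ γ : Fin w → MvPolynomial (Fin n × Fin n) ℂ)
      (L : Matrix (Fin w) (Fin w) (MvPolynomial (Fin n × Fin n) ℂ)),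
      3 ≤ n → (∀ i, (ρ i).IsHomogeneous 1) → (∀ i, (γ i).IsHomogeneous 1) →
      (∀ i j, (L i j).IsHomogeneous 1) →
      ρ ⬝ᵥ ((L ^ (n - 2)) *ᵥ γ) = perPoly (Fin n) ℂ →
      (∀ j : ℕ, j < n - 2 → ρ ⬝ᵥ ((L ^ j) *ᵥ γ) = 0) →
      (haveI : NeZero (w + 1) := ⟨Nat.succ_ne_zero w⟩; HasBorderDetRepr ℂ n (w + 1)) := by
  sorry  -- LANDED as Summit.ValiantsHypothesis.ValiantsHypothesis.Theorems.DetQPDetqpSuperquadratic.stub_krylovBorder (p97435, = krylovBorder_of_B123 below); imported once the farm has built the module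

/-- Registered stub **S2½** `stub_krylovMRFloor` — LANDED (p87997 ACCEPTED,
`Theorems/DetQPDetqpSuperquadraticStubKrylovMRFloor.lean`, lead gen 0): the Mignon–Ressayre floor INSIDE the
Krylov model, `n² ≤ 2w + 4`.  Kept as a placeholder only until the farm has built that module (then:
import + one-line proof, exactly as S1a/S1b/S2 above). -/
theorem stub_krylovMRFloor :
    ∀ (n w : ℕ) (ρ γ : Fin w → MvPolynomial (Fin n × Fin n) ℂ)
      (L : Matrix (Fin w) (Fin w) (MvPolynomial (Fin n × Fin n) ℂ)),
      3 ≤ n → (∀ i, (ρ i).IsHomogeneous 1) → (∀ i, (γ i).IsHomogeneous 1) →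
      (∀ i j, (L i j).IsHomogeneous 1) →
      ρ ⬝ᵥ ((L ^ (n - 2)) *ᵥ γ) = perPoly (Fin n) ℂ →
      (∀ j : ℕ, j < n - 2 → ρ ⬝ᵥ ((L ^ j) *ᵥ γ) = 0) →
      (∀ j : ℕ, perPoly (Fin n) ℂ ∣ ρ ⬝ᵥ ((L ^ j) *ᵥ γ)) →
      n ^ 2 ≤ 2 * w + 4 := by
  sorry  -- LANDED as Summit.ValiantsHypothesis.ValiantsHypothesis.Theorems.DetQPDetqpSuperquadratic.stub_krylovMRFloor (p87997); imported once the farm has built the module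

/-- Registered stub **S3** `stub_krylovWidthSuperquadratic` (OPEN, hardest, load-bearing — the transfer
`C⁺` BEYOND THE MR FLOOR, v4 signature): for all large `n`, every Krylov normal form of `per_n` of width
`w` ((A3), (A2), (A4)), handed as free hypotheses its power-trace twin of size `2w + 1` (S2), the floor
`n² ≤ 2w + 4` (S2½) AND the border expression `X₀₀^(w+1−n) per_n ∈ Δ[det_(w+1)]` (B1–B3), has
`n^(2+ε) ≤ w + 1`.  SANDWICH: implied by the border crux (`krylovWidthSuperquadratic_stub_of_border`),
implies the crux (`DetqpSuperquadratic_of`). -/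
theorem stub_krylovWidthSuperquadratic :
    ∃ ε : ℝ, 0 < ε ∧ ∃ n₀ : ℕ, ∀ n ≥ n₀, ∀ (w : ℕ)
      (ρ γ : Fin w → MvPolynomial (Fin n × Fin n) ℂ)
      (L : Matrix (Fin w) (Fin w) (MvPolynomial (Fin n × Fin n) ℂ)),
      (∀ i, (ρ i).IsHomogeneous 1) → (∀ i, (γ i).IsHomogeneous 1) →
      (∀ i j, (L i j).IsHomogeneous 1) →
      ρ ⬝ᵥ ((L ^ (n - 2)) *ᵥ γ) = perPoly (Fin n) ℂ →
      (∀ j : ℕ, j < n - 2 → ρ ⬝ᵥ ((L ^ j) *ᵥ γ) = 0) →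
      (∀ j : ℕ, perPoly (Fin n) ℂ ∣ ρ ⬝ᵥ ((L ^ j) *ᵥ γ)) →
      HasPowTraceRepr ℂ (perPoly (Fin n) ℂ) n (2 * w + 1) →
      n ^ 2 ≤ 2 * w + 4 →
      (haveI : NeZero (w + 1) := ⟨Nat.succ_ne_zero w⟩; HasBorderDetRepr ℂ n (w + 1)) →
      (n : ℝ) ^ (2 + ε) ≤ (w : ℝ) + 1 := by
  sorry

/-! ## Glue (sorry-free): the planner's `Prop`s from the landed theorems and the registered stubs -/

/-- S1a from the landed theorem (definitional). -/
theorem vertexGauge : VertexGauge := fun n hn w h => stub_vertexGauge n hn w h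

/-- `per_n` (on `Fin n × Fin n`) is homogeneous of degree `n`. -/
theorem perPoly_isHomogeneous_fin' (n : ℕ) : (perPoly (Fin n) ℂ).IsHomogeneous n := by
  simpa using (perPoly_isHomogeneous (n := Fin n) (k := ℂ))

/-- S1b from the landed theorem at `K = ℂ`, `f = per_n` (witnesses `(ρ, γ, −L)`). -/
theorem krylovIdentities : KrylovIdentities := by
  intro n hn w h
  obtain ⟨ρ, γ, L, hρ, hγ, hL, hadj⟩ := h
  obtain ⟨hA3, hA2, hA4⟩ := stub_krylovIdentities ℂ (Fin n × Fin n) n w (perPoly (Fin n) ℂ) ρ γ L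
    (by omega) (perPoly_isHomogeneous_fin' n) hρ hγ hL hadj
  refine ⟨ρ, γ, -L, hρ, hγ, fun i j => ?_, hA3, hA2, hA4⟩
  rw [Matrix.neg_apply]
  exact (hL i j).neg

/-- S2 from the landed theorem at `f = per_n`. -/
theorem traceUnrolling : TraceUnrolling := by
  intro n hn w hK
  obtain ⟨ρ, γ, L, hρ, hγ, hL, hA3, hA2, -⟩ := hK
  exact stub_traceUnrolling (Fin n × Fin n) n w (perPoly (Fin n) ℂ) ρ γ L (by omega) hρ hγ hL hA3 hA2

/-! ### The border sandwich (v4): a Krylov form of width `w` is a border expression of size `w + 1` -/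

/-- **Cayley–Hamilton forces `w + 1 ≥ n`** (verbatim copy of the landed
`KrylovFloor.width_ge_of_krylov`, p87997, until the farm has built that module): a Krylov presentation
`ρᵀ L^(m+1) γ = f ≠ 0` with `ρᵀ Lʲ γ = 0` for `j < m + 1` has width `w ≥ m + 2`. [folklore] -/
theorem width_ge_of_krylov {S : Type*} [CommRing S] [Nontrivial S] {m w : ℕ}
    (ρ γ : Fin w → S) (L : Matrix (Fin w) (Fin w) S) {f : S} (hf : f ≠ 0)
    (hA3 : ρ ⬝ᵥ (L ^ (m + 1) *ᵥ γ) = f) (hA2 : ∀ j : ℕ, j < m + 1 → ρ ⬝ᵥ (L ^ j *ᵥ γ) = 0) :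
    m + 2 ≤ w := by
  by_contra hlt
  push Not at hlt
  have hCH := Matrix.aeval_self_charpoly L
  rw [Polynomial.aeval_eq_sum_range, Matrix.charpoly_natDegree_eq_dim, Fintype.card_fin] at hCH
  have h0 : ρ ⬝ᵥ ((L ^ (m + 1 - w) * ∑ k ∈ Finset.range (w + 1), L.charpoly.coeff k • L ^ k) *ᵥ γ)
      = 0 := by
    rw [hCH, Matrix.mul_zero, Matrix.zero_mulVec, dotProduct_zero]
  rw [Finset.mul_sum, Matrix.sum_mulVec, dotProduct_sum, Finset.sum_range_succ,
    Finset.sum_eq_zero, zero_add, Matrix.mul_smul, ← pow_add,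
    show m + 1 - w + w = m + 1 by omega, Matrix.smul_mulVec, dotProduct_smul, hA3] at h0
  · have hmon : L.charpoly.coeff w = 1 := by
      have h := L.charpoly_monic.coeff_natDegree
      rwa [Matrix.charpoly_natDegree_eq_dim, Fintype.card_fin] at h
    rw [hmon, one_smul] at h0
    exact hf h0
  · intro k hk
    rw [Matrix.mul_smul, ← pow_add, Matrix.smul_mulVec, dotProduct_smul,
      hA2 _ (by have := Finset.mem_range.1 hk; omega), smul_zero]

/-- Cayley–Hamilton: Krylov data (A2), (A3) for `per_n`, `n ≥ 3`, have `n ≤ w + 1`. -/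
theorem le_width_succ_of_krylov {n w : ℕ} (hn : 3 ≤ n)
    {ρ γ : Fin w → MvPolynomial (Fin n × Fin n) ℂ}
    {L : Matrix (Fin w) (Fin w) (MvPolynomial (Fin n × Fin n) ℂ)}
    (hA3 : ρ ⬝ᵥ ((L ^ (n - 2)) *ᵥ γ) = perPoly (Fin n) ℂ)
    (hA2 : ∀ j : ℕ, j < n - 2 → ρ ⬝ᵥ ((L ^ j) *ᵥ γ) = 0) : n ≤ w + 1 := by
  obtain ⟨m, rfl⟩ : ∃ m, n = m + 3 := ⟨n - 3, by omega⟩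
  rw [show m + 3 - 2 = m + 1 from rfl] at hA3 hA2
  have h := width_ge_of_krylov ρ γ L (perPoly_ne_zero _ _) hA3 hA2
  omega

/-- The initial form of an affine determinantal expression is a degeneration: if `F = det A` with `A`
affine of size `m ≥ n`, `F` has no component of degree `< n` and degree-`n` component `per_n`, then
`X₀₀^(m−n) per_n ∈ Δ[det_m]` (from B1, B2; the case `m = n` is Mulmuley–Sohoni Prop. 4.4 in tree). -/
theorem hasBorderDetRepr_of_initialForm {n m : ℕ} [NeZero m] (F : MvPolynomial (Fin n × Fin n) ℂ)
    (hnm : n ≤ m) (hF : HasDetRepr F m) (hlow : ∀ d : ℕ, d < n → homogeneousComponent d F = 0)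
    (htop : homogeneousComponent n F = perPoly (Fin n) ℂ) : HasBorderDetRepr ℂ n m := by
  classical
  rcases Nat.eq_or_lt_of_le hnm with h | h
  · -- `m = n`: `F = per_n` itself
    subst h
    have hdeg : F.totalDegree ≤ n := totalDegree_le_of_hasDetRepr_holds hF
    have hdn : n ≤ F.totalDegree := by
      by_contra hlt
      rw [homogeneousComponent_eq_zero _ _ (by omega)] at htop
      exact perPoly_ne_zero _ _ htop.symm
    have hFeq : F = perPoly (Fin n) ℂ := by
      rw [← htop]
      conv_lhs => rw [← sum_homogeneousComponent F]
      rw [Finset.sum_eq_single_of_mem n (Finset.mem_range.2 (by omega))]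
      intro d hd hdn
      have hd' := Finset.mem_range.1 hd
      rcases Nat.lt_or_gt_of_ne hdn with hlt | hgt
      · exact hlow d hlt
      · exact homogeneousComponent_eq_zero _ _ (lt_of_le_of_lt hdeg hgt)
    rw [hFeq] at hF
    exact paddedPerPoly_mem_orbitClosure_detPoly_of_hasDetRepr_holds hF le_rfl
  · -- `n < m`: place the block, homogenise with `X₀₀`, rescale, take the Zariski limit
    set e : Fin n ≃ BlockIdx n m := (Fintype.equivFinOfCardEq (card_blockIdx hnm)).symm with he
    set ι : Fin n × Fin n → Fin m × Fin m := fun ij => ((e ij.1 : Fin m), (e ij.2 : Fin m)) with hι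
    have hy : ((0 : Fin m), (0 : Fin m)) ∉ Set.range ι := by
      rintro ⟨ij, hij⟩
      have h1 : ((e ij.1 : Fin m) : ℕ) = 0 := by
        have := congrArg Prod.fst hij
        simp only [hι] at this
        rw [this]; rfl
      have h2 := (e ij.1).2
      omega
    set P : ℕ → MvPolynomial (Fin m × Fin m) ℂ := fun e' =>
      X ((0 : Fin m), (0 : Fin m)) ^ (m - n - e') * rename ι (homogeneousComponent (n + e') F) with hP
    have hfam := stub_initialFormFamily n m F ι ((0 : Fin m), (0 : Fin m)) hy hnm hF hlow
    have hlim : P 0 ∈ orbitClosure (detPoly (Fin m) ℂ) := by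
      refine stub_zariskiLimit (Fin m × Fin m) (detPoly (Fin m) ℂ) P (m - n) fun t ht => ?_
      exact endOrbit_subset_orbitClosure_holds _ (hfam t ht)
    have hP0 : P 0 = paddedPerPoly ℂ n m := by
      simp only [hP, Nat.sub_zero, add_zero, htop]
      rw [paddedPerPoly, ← rename_perPoly_equiv e, rename_rename]
      rfl
    rwa [hP0] at hlim

/-- **A Krylov form of width `w` is a border determinantal expression of size `w + 1`** (only (A2) and
(A3) are used): `X₀₀^(w+1−n) per_n ∈ Δ[det_(w+1)]` — the DERIVATION of B4 from B1–B3 (sorry-free modulo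
those three stubs; this is the text landed in `Theorems/DetQPDetqpSuperquadraticKrylovBorder.lean`). -/
theorem krylovBorder_of_B123 {n w : ℕ} (hn : 3 ≤ n)
    {ρ γ : Fin w → MvPolynomial (Fin n × Fin n) ℂ}
    {L : Matrix (Fin w) (Fin w) (MvPolynomial (Fin n × Fin n) ℂ)}
    (hρ : ∀ i, (ρ i).IsHomogeneous 1) (hγ : ∀ i, (γ i).IsHomogeneous 1)
    (hL : ∀ i j, (L i j).IsHomogeneous 1)
    (hA3 : ρ ⬝ᵥ ((L ^ (n - 2)) *ᵥ γ) = perPoly (Fin n) ℂ)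
    (hA2 : ∀ j : ℕ, j < n - 2 → ρ ⬝ᵥ ((L ^ j) *ᵥ γ) = 0) :
    (haveI : NeZero (w + 1) := ⟨Nat.succ_ne_zero w⟩; HasBorderDetRepr ℂ n (w + 1)) := by
  haveI : NeZero (w + 1) := ⟨Nat.succ_ne_zero w⟩
  obtain ⟨hdet, hlow, htop⟩ := stub_krylovAdjugateOrder n w ρ γ L (by omega) hρ hγ hL hA3 hA2
  exact hasBorderDetRepr_of_initialForm _ (le_width_succ_of_krylov hn hA3 hA2) hdet hlow htop

/-- B4 as used by the composition: from the registered stub `stub_krylovBorder`. -/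
theorem krylovBorder {n w : ℕ} (hn : 3 ≤ n)
    {ρ γ : Fin w → MvPolynomial (Fin n × Fin n) ℂ}
    {L : Matrix (Fin w) (Fin w) (MvPolynomial (Fin n × Fin n) ℂ)}
    (hρ : ∀ i, (ρ i).IsHomogeneous 1) (hγ : ∀ i, (γ i).IsHomogeneous 1)
    (hL : ∀ i j, (L i j).IsHomogeneous 1)
    (hA3 : ρ ⬝ᵥ ((L ^ (n - 2)) *ᵥ γ) = perPoly (Fin n) ℂ)
    (hA2 : ∀ j : ℕ, j < n - 2 → ρ ⬝ᵥ ((L ^ j) *ᵥ γ) = 0) :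
    (haveI : NeZero (w + 1) := ⟨Nat.succ_ne_zero w⟩; HasBorderDetRepr ℂ n (w + 1)) :=
  stub_krylovBorder n w ρ γ L hn hρ hγ hL hA3 hA2

/-- `bdc(per_n) ≤ kw + 1`: the border determinantal complexity of the permanent is at most one more than
the width of any Krylov form ((A2), (A3) suffice). With `kw ≤ dc − 1` (S1a, S1b) this is the sandwich
`bdc(per_n) ≤ kw(per_n) + 1 ≤ dc(per_n)`. -/
theorem borderDetComplexityPer_le_of_krylov {n w : ℕ} (hn : 3 ≤ n)
    {ρ γ : Fin w → MvPolynomial (Fin n × Fin n) ℂ}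
    {L : Matrix (Fin w) (Fin w) (MvPolynomial (Fin n × Fin n) ℂ)}
    (hρ : ∀ i, (ρ i).IsHomogeneous 1) (hγ : ∀ i, (γ i).IsHomogeneous 1)
    (hL : ∀ i j, (L i j).IsHomogeneous 1)
    (hA3 : ρ ⬝ᵥ ((L ^ (n - 2)) *ᵥ γ) = perPoly (Fin n) ℂ)
    (hA2 : ∀ j : ℕ, j < n - 2 → ρ ⬝ᵥ ((L ^ j) *ᵥ γ) = 0) :
    borderDetComplexityPer ℂ n ≤ w + 1 :=
  Nat.sInf_le ⟨Nat.succ_pos w, le_width_succ_of_krylov hn hA3 hA2, krylovBorder hn hρ hγ hL hA3 hA2⟩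

/-- **Upper half of the sandwich: the border crux implies S3** (registered v4 signature, verbatim):
if `n^(2+ε) ≤ bdc(per_n)` for all large `n`, then every Krylov form has `n^(2+ε) ≤ w + 1` — using of
S3's hypotheses only (A2), (A3) (for `n ≤ w + 1`) and the border expression. -/
theorem krylovWidthSuperquadratic_stub_of_border
    (hB : ∃ ε : ℝ, 0 < ε ∧ ∃ n₀ : ℕ, ∀ n ≥ n₀,
      (n : ℝ) ^ (2 + ε) ≤ (borderDetComplexityPer ℂ n : ℝ)) :
    ∃ ε : ℝ, 0 < ε ∧ ∃ n₀ : ℕ, ∀ n ≥ n₀, ∀ (w : ℕ)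
      (ρ γ : Fin w → MvPolynomial (Fin n × Fin n) ℂ)
      (L : Matrix (Fin w) (Fin w) (MvPolynomial (Fin n × Fin n) ℂ)),
      (∀ i, (ρ i).IsHomogeneous 1) → (∀ i, (γ i).IsHomogeneous 1) →
      (∀ i j, (L i j).IsHomogeneous 1) →
      ρ ⬝ᵥ ((L ^ (n - 2)) *ᵥ γ) = perPoly (Fin n) ℂ →
      (∀ j : ℕ, j < n - 2 → ρ ⬝ᵥ ((L ^ j) *ᵥ γ) = 0) →
      (∀ j : ℕ, perPoly (Fin n) ℂ ∣ ρ ⬝ᵥ ((L ^ j) *ᵥ γ)) →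
      HasPowTraceRepr ℂ (perPoly (Fin n) ℂ) n (2 * w + 1) →
      n ^ 2 ≤ 2 * w + 4 →
      (haveI : NeZero (w + 1) := ⟨Nat.succ_ne_zero w⟩; HasBorderDetRepr ℂ n (w + 1)) →
      (n : ℝ) ^ (2 + ε) ≤ (w : ℝ) + 1 := by
  obtain ⟨ε, hε, n₀, H⟩ := hB
  refine ⟨ε, hε, max n₀ 3, fun n hn w ρ γ L hρ hγ hL hA3 hA2 _ _ _ hbd => ?_⟩
  have hn₀ : n₀ ≤ n := le_trans (le_max_left _ _) hn
  have hn3 : 3 ≤ n := le_trans (le_max_right _ _) hn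
  have hle : borderDetComplexityPer ℂ n ≤ w + 1 :=
    Nat.sInf_le ⟨Nat.succ_pos w, le_width_succ_of_krylov hn3 hA3 hA2, hbd⟩
  have hle' : (borderDetComplexityPer ℂ n : ℝ) ≤ (w : ℝ) + 1 := by exact_mod_cast hle
  exact (H n hn₀).trans hle'

/-- S3 (v1 `Prop`, conclusion `≤ w + 1`) from the registered stubs: unfold `HasKrylovRepr`; the floor
hypothesis is discharged by the landed `stub_krylovMRFloor`, the border hypothesis by `krylovBorder`
(B1–B3), at the cost of `n₀ ↦ max n₀ 3`. -/
theorem krylovWidthSuperquadratic : KrylovWidthSuperquadratic := by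
  obtain ⟨ε, hε, n₀, H⟩ := stub_krylovWidthSuperquadratic
  refine ⟨ε, hε, max n₀ 3, fun n hn w hK hT => ?_⟩
  have hn₀ : n₀ ≤ n := le_trans (le_max_left _ _) hn
  have hn3 : 3 ≤ n := le_trans (le_max_right _ _) hn
  obtain ⟨ρ, γ, L, hρ, hγ, hL, hA3, hA2, hA4⟩ := hK
  exact H n hn₀ w ρ γ L hρ hγ hL hA3 hA2 hA4 hT
    (stub_krylovMRFloor n w ρ γ L hn3 hρ hγ hL hA3 hA2 hA4) (krylovBorder hn3 hρ hγ hL hA3 hA2)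

/-! ## Composition (sorry-free apart from the registered stubs): the crux, BY NAME -/

/-- `dc(per_n) ≥ 1` for `n ≥ 1`: `dc ≥ totalDegree = n`. -/
theorem one_le_determinantalComplexity_perPoly {n : ℕ} (hn : 1 ≤ n) :
    1 ≤ determinantalComplexity (perPoly (Fin n) ℂ) := by
  have h1 : (perPoly (Fin n) ℂ).totalDegree ≤ determinantalComplexity (perPoly (Fin n) ℂ) :=
    totalDegree_le_determinantalComplexity_holds _
  have h2 : (perPoly (Fin n) ℂ).totalDegree = Fintype.card (Fin n) := totalDegree_perPoly_holds
  rw [Fintype.card_fin] at h2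
  omega

/-- **The line concludes the crux** (modulo the registered stubs).  From S3 take `ε, n₀`; for
`n ≥ max n₀ 3` the determinantal complexity `m = dc(per_n)` is attained and positive, so `m = w + 1`;
S1a/S1b (landed) put the attained expression in Krylov normal form of width `w`, S2 (landed) supplies its
power-trace twin of size `2w + 1`, and S3 gives `n^(2+ε) ≤ w + 1 = m`. -/
theorem DetqpSuperquadratic_of :
    Summit.ValiantsHypothesis.ValiantsHypothesis.Theses.DetQP.DetqpSuperquadratic := by
  obtain ⟨ε, hε, n₀, hW⟩ := krylovWidthSuperquadratic
  refine ⟨ε, hε, max n₀ 3, fun n hn => ?_⟩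
  have hn₀ : n₀ ≤ n := le_trans (le_max_left _ _) hn
  have hn3 : 3 ≤ n := le_trans (le_max_right _ _) hn
  have hatt : HasDetRepr (perPoly (Fin n) ℂ) (determinantalComplexity (perPoly (Fin n) ℂ)) :=
    hasDetRepr_determinantalComplexity_holds _
  have hpos : 1 ≤ determinantalComplexity (perPoly (Fin n) ℂ) :=
    one_le_determinantalComplexity_perPoly (by omega)
  obtain ⟨w, hw⟩ : ∃ w : ℕ, determinantalComplexity (perPoly (Fin n) ℂ) = w + 1 :=
    ⟨determinantalComplexity (perPoly (Fin n) ℂ) - 1, by omega⟩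
  rw [hw] at hatt
  have hK : HasKrylovRepr n w := krylovIdentities n hn3 w (vertexGauge n hn3 w hatt)
  have hT : HasPowTraceRepr ℂ (perPoly (Fin n) ℂ) n (2 * w + 1) := traceUnrolling n hn3 w hK
  have hle : (n : ℝ) ^ (2 + ε) ≤ (w : ℝ) + 1 := hW n hn₀ w hK hT
  calc (n : ℝ) ^ (2 + ε) ≤ (w : ℝ) + 1 := hle
    _ = (determinantalComplexity (perPoly (Fin n) ℂ) : ℝ) := by rw [hw]; push_cast; ring

/-- The shared item's other name, BY NAME: route UlrichPadded's `Superquadratic` is the same term. -/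
theorem Superquadratic_of :
    Summit.ValiantsHypothesis.ValiantsHypothesis.Theses.UlrichPadded.Superquadratic :=
  DetqpSuperquadratic_of

/-! ## By-products (sorry-free given the landed theorems / the v4 stubs) -/

/-- **Linear homogenisation** `pc(per_n) + 1 ≤ 2·dc(per_n)` for `n ≥ 3` — an unconditional TREE theorem
since wave 1 (`powTraceComplexity_add_one_le_two_mul_dc_perPoly`, file `…LinearHomogenisation`, not yet
built on the farm; re-derived here from the three landed stubs). -/
theorem linearHomogenisation {n : ℕ} (hn : 3 ≤ n) :
    powTraceComplexity ℂ (perPoly (Fin n) ℂ) n + 1 ≤ 2 * determinantalComplexity (perPoly (Fin n) ℂ) := by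
  have hatt : HasDetRepr (perPoly (Fin n) ℂ) (determinantalComplexity (perPoly (Fin n) ℂ)) :=
    hasDetRepr_determinantalComplexity_holds _
  have hpos : 1 ≤ determinantalComplexity (perPoly (Fin n) ℂ) :=
    one_le_determinantalComplexity_perPoly (by omega)
  obtain ⟨w, hw⟩ : ∃ w : ℕ, determinantalComplexity (perPoly (Fin n) ℂ) = w + 1 :=
    ⟨determinantalComplexity (perPoly (Fin n) ℂ) - 1, by omega⟩
  rw [hw] at hatt ⊢
  have hT : HasPowTraceRepr ℂ (perPoly (Fin n) ℂ) n (2 * w + 1) :=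
    traceUnrolling n hn w (krylovIdentities n hn w (vertexGauge n hn w hatt))
  have hpc : powTraceComplexity ℂ (perPoly (Fin n) ℂ) n ≤ 2 * w + 1 := Nat.sInf_le hT
  omega

/-- **Non-vacuity of S3's hypothesis class**: for `n ≥ 3` the attained determinantal complexity
`dc(per_n) = w + 1` yields a Krylov normal form of width `w` with its power-trace twin. -/
theorem exists_krylov_at_dc {n : ℕ} (hn : 3 ≤ n) :
    ∃ w : ℕ, w + 1 = determinantalComplexity (perPoly (Fin n) ℂ) ∧ HasKrylovRepr n w ∧
      HasPowTraceRepr ℂ (perPoly (Fin n) ℂ) n (2 * w + 1) := by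
  have hatt : HasDetRepr (perPoly (Fin n) ℂ) (determinantalComplexity (perPoly (Fin n) ℂ)) :=
    hasDetRepr_determinantalComplexity_holds _
  have hpos : 1 ≤ determinantalComplexity (perPoly (Fin n) ℂ) :=
    one_le_determinantalComplexity_perPoly (by omega)
  obtain ⟨w, hw⟩ : ∃ w : ℕ, determinantalComplexity (perPoly (Fin n) ℂ) = w + 1 :=
    ⟨determinantalComplexity (perPoly (Fin n) ℂ) - 1, by omega⟩
  rw [hw] at hatt
  have hK : HasKrylovRepr n w := krylovIdentities n hn w (vertexGauge n hn w hatt)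
  exact ⟨w, hw.symm, hK, traceUnrolling n hn w hK⟩

/-- **The sandwich at the level of complexities** (modulo B1–B3): for `n ≥ 3`, every Krylov form of
width `w` has `bdc(per_n) ≤ w + 1`, and one of width `dc(per_n) − 1` exists; in particular
`bdc(per_n) ≤ dc(per_n)` is recovered through the Krylov class. -/
theorem borderDetComplexityPer_le_krylovWidth_succ {n w : ℕ} (hn : 3 ≤ n) (h : HasKrylovRepr n w) :
    borderDetComplexityPer ℂ n ≤ w + 1 := by
  obtain ⟨ρ, γ, L, hρ, hγ, hL, hA3, hA2, -⟩ := h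
  exact borderDetComplexityPer_le_of_krylov hn hρ hγ hL hA3 hA2

/-! ## Calibration of S3 (proved): attacks that each prove it -/

/-- Card 2's transfer target: super-quadratic bordered power width, no side identities. -/
def PowerWidthSuperquadratic : Prop :=
  ∃ ε : ℝ, 0 < ε ∧ ∃ n₀ : ℕ, ∀ n ≥ n₀, ∀ w : ℕ,
    HasBorderedPowerRepr (perPoly (Fin n) ℂ) n w → (n : ℝ) ^ (2 + ε) ≤ (w : ℝ)

/-- The pc-model target: every power-trace expression has size `≥ 2n^(2+ε) + 1`. -/
def PcSuperquadratic : Prop :=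
  ∃ ε : ℝ, 0 < ε ∧ ∃ n₀ : ℕ, ∀ n ≥ n₀, ∀ p : ℕ,
    HasPowTraceRepr ℂ (perPoly (Fin n) ℂ) n p → 2 * (n : ℝ) ^ (2 + ε) + 1 ≤ (p : ℝ)

/-- The border crux: super-quadratic border determinantal complexity of the permanent. -/
def BorderSuperquadratic : Prop :=
  ∃ ε : ℝ, 0 < ε ∧ ∃ n₀ : ℕ, ∀ n ≥ n₀, (n : ℝ) ^ (2 + ε) ≤ (borderDetComplexityPer ℂ n : ℝ)

/-- (T1) A width bound ignoring the side identities proves S3. -/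
theorem krylovWidthSuperquadratic_of_powerWidth (h : PowerWidthSuperquadratic) :
    KrylovWidthSuperquadratic := by
  obtain ⟨ε, hε, n₀, H⟩ := h
  refine ⟨ε, hε, n₀, fun n hn w hK _ => ?_⟩
  have := H n hn w hK.hasBorderedPowerRepr
  linarith

/-- (T2) A power-trace (same-space, unpadded GCT) bound proves S3. -/
theorem krylovWidthSuperquadratic_of_pc (h : PcSuperquadratic) : KrylovWidthSuperquadratic := by
  obtain ⟨ε, hε, n₀, H⟩ := h
  refine ⟨ε, hε, n₀, fun n hn w _ hT => ?_⟩
  have h1 : 2 * (n : ℝ) ^ (2 + ε) + 1 ≤ ((2 * w + 1 : ℕ) : ℝ) := H n hn (2 * w + 1) hT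
  push_cast at h1
  have h0 : (0 : ℝ) ≤ (n : ℝ) ^ (2 + ε) := by positivity
  linarith

/-- (T3, v4) **The border crux proves S3** (modulo B1–B3 through `krylovBorder`). -/
theorem krylovWidthSuperquadratic_of_border (h : BorderSuperquadratic) : KrylovWidthSuperquadratic := by
  obtain ⟨ε, hε, n₀, H⟩ := h
  refine ⟨ε, hε, max n₀ 3, fun n hn w hK _ => ?_⟩
  have hn₀ : n₀ ≤ n := le_trans (le_max_left _ _) hn
  have hn3 : 3 ≤ n := le_trans (le_max_right _ _) hn
  have hle : (borderDetComplexityPer ℂ n : ℝ) ≤ (w : ℝ) + 1 := by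
    exact_mod_cast borderDetComplexityPer_le_krylovWidth_succ hn3 hK
  exact (H n hn₀).trans hle

end Summit.ValiantsHypothesis.ValiantsHypothesis.Cruxes.DetqpSuperquadratic.LinearHomogenisationTransfer
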